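import Summits.QuantumFields.BalabanUV.T4Continuum.Support.HolonomyTowerRegularBridge

/-!
# T⁴ programme, spine node NE2 (U1a) — THE DAG EDGE NE2 ⇐ NE3 ON ANY READINGS CARRIER: functoriality of node U1b's `LocalRate` under
# carrier maps, and ROOT B's `hNE3` as the local half of a datum-indexed carrier (referee condition c7 of `t4/formal/NE2/REFEREE.md`)

NE2 formalisation swarm `b2b-balaban-t4-ne2-formalise-*`, leaf prover 08 (gen 2; row B7's lineage), leaf-proposed SUPPORT row «B6′ c7-adapter»
(CLAIMS.log 2026-08-20 INTENT; the owner lineage t4-ne2-p1 / the typer may book, rename or refuse).  Module 1 of 2 (module 2: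
`Spine/NE2BalabanFromNE3` plugs the NE3 lineage's own carrier `MinimalActionRate.minActReadings` BY NAME).

WHY.  Row B6 (`Support/NE2FromNE3`, the owner's) makes the edge NE2(tier B) ⇐ NE3 literal on OUR readings object: ROOT B
(`Spine/NE2BalabanThreshold.balaban_final_rate_of_regular`) displays `hNE3 : LocalRate (bgReadings L M (regClass L M (liftR L M Rg))) C L⁻¹`
— node U1b's predicate `T4EtaRateMin.LocalRate` on the readings `bgReadings 𝒟` of a CLASS OF COEFFICIENT TOWERS (data = the towers
themselves).  The NE3 lineage's carriers are indexed by the UNIT-LATTICE DATUM `V` (two runs for the same `V`), with a local reading at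
unit-scale sites; the referee's condition c7 asks for the ADAPTER between the two.  This file is that adapter at the level of
`T4EtaRateMin.Readings`, for ANY datum-indexed carrier:
 * §1 `towerLoc L M` — the local reading of ONE tower (`= (bgReadings L M 𝒟).loc` for every `𝒟`, `rfl`): at the unit-scale site
   `s = (x₀, r, μ, ν, a, b, re/im)` and step `k`, `Re/Im (W k ν (pt x₀ r k, μ) a b)`; `localRate_bgReadings_iff` (`Iff.rfl`).
 * §2 CARRIER FUNCTORIALITY of node U1b's shape: `localRate_of_readingMap` (pull-back along any pair of maps `(f, g)` of data and sites
   intertwining the readings) and **`localRate_iff_forall_bgReadings`**: if a carrier `R : Readings ι (J × Site L M o)` reads, at `(j, s)`,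
   the NE2 entry-reading of the `j`-th tower `𝒲 V j` of the datum `V`, then
   `LocalRate R C θ ↔ ∀ V ∈ R.dom, LocalRate (bgReadings L M (Set.range (𝒲 V))) C θ` — faithful BOTH ways.
 * §3/§4 the two classes node NE3 is asked about, as ranges of finite families — row B5's `regClass R = {w, D_νw_ν}` is
   `Set.range (regFamily L M R)` (`Bool`-indexed), row B2.w's `regClass₂ Rb = {w} ∪ {D_lam w}` (the referee's c11 class) is
   `Set.range (regFamily₂ L M Rb)` (`Option (Fin d)`-indexed) —, **THE NE2 LOCAL READINGS OF A DATUM-INDEXED FAMILY OF BACKGROUND TOWERS**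
   `ne2Loc L M Rt` / `ne2Loc₂ L M Rb` (for `Rt : ι → tower` DATA — no assertion that `Rt V` is the transporter tower of Bałaban's minimisers
   `U_k(V)`, trigger c5), and the adapters **`localRate_iff_forall_regClass`**:
   `R.loc = ne2Loc L M Rt → (LocalRate R C θ ↔ ∀ V ∈ R.dom, LocalRate (bgReadings L M (regClass L M (Rt V))) C θ)`,
   **`localRate_iff_forall_regClass₂`** likewise — i.e. ROOT B's `hNE3` (and row B2.w's) for EVERY datum of the domain IS the local half of
   node U1b's shape on any `V`-indexed carrier carrying the NE2 reading; `localRate_regClass_of_localRate_lev` adds the rate monotonicity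
   `θ ≤ L⁻¹ ⇒ L⁻¹` (`T4EtaRateMin.LocalRate.mono` BY NAME); `localRate_of_forall_consistent` is the supplier's recipe (row B6's
   `localRate_of_consistent` per datum).

HONEST FRAMING (T4-DAG p. 1).  Pure bookkeeping (definitional unfoldings, two set equalities, one monotonicity); proves NOTHING about Bałaban's
minimisers; node NE3 is OPEN — no `LocalRate` hypothesis is discharged here, for any carrier; `Rt`/`Rb` are DATA (no B0); ROOT B stays CONDITIONAL
on node NE3 + row B5's (3.35)-shape class + `η ≤ η⋆`; NE2 (U1a) NOT proved (c1 with the carver); spine PROVED 0/9 unchanged; NOT infinite volume /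
mass gap / Clay.  HONEST DEPENDENCY: continuum YM on T⁴ ⇐ BetaPertH ∧ nine spine estimates (0/9 proved); BetaPertH ⇐ (D1) ∧ (D4) ∧ CAP+tail; G-an2-4
gates asym, D1 and NE2/3/4.  ABSOLUTE RULE kept (nothing internally minted enters as a cited fact); no `def … : Prop` fact; no `sorry`.
-/

noncomputable section

open scoped BigOperators ComplexConjugate Matrix Matrix.Norms.L2Operator

namespace Summit.QuantumFields.BalabanUV.T4Continuum.NE2FromNE3Carrier

open Literature.MathematicalPhysics.QuantumFieldTheory.Balaban1983to89.B5Prop11Plancherel (fine Tor)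
open Literature.MathematicalPhysics.QuantumFieldTheory.Balaban1983to89.B5G183RateUnitTower (lev lev_neZero)
open Literature.MathematicalPhysics.QuantumFieldTheory.Balaban1983to89.T4EtaRateMin (Readings LocalRate)
open Summit.QuantumFields.BalabanUV.T4Continuum
open Summit.QuantumFields.BalabanUV.T4Continuum.BalabanAveragedTowerUnit (idx)
open Summit.QuantumFields.BalabanUV.T4Continuum.NE2FromNE3 (Site entryAt bgReadings)
open Summit.QuantumFields.BalabanUV.T4Continuum.RegularBackgroundTower (connTower dconnTower regClass)
open Summit.QuantumFields.BalabanUV.T4Continuum.HolonomyTowerRegular (wT DqT regClass₂)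

variable {d : ℕ} (L : ℕ) (M : Fin d → ℕ) {o : Type*}

/-! ## §1 The local reading of one coefficient tower -/

/-- **THE NE2 LOCAL READING OF ONE COEFFICIENT TOWER** `W : (k : ℕ) → Fin d → idx L M k → M_o(ℂ)` at a unit-scale site and step `k`:
`Re/Im (W k ν (pt x₀ r k, μ) a b)` — BY NAME the `loc` field of row B6's `NE2FromNE3.bgReadings` (which does not depend on the class). [folklore] -/
def towerLoc : ℕ → ((k : ℕ) → Fin d → (idx L M k → Matrix o o ℂ)) → Site L M o → ℝ :=
  (bgReadings L M (Set.univ : Set ((k : ℕ) → Fin d → (idx L M k → Matrix o o ℂ)))).loc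

/-- `(bgReadings 𝒟).loc = towerLoc` for every class `𝒟`. [folklore] -/
@[simp] theorem bgReadings_loc (𝒟 : Set ((k : ℕ) → Fin d → (idx L M k → Matrix o o ℂ))) : (bgReadings L M 𝒟).loc = towerLoc L M := rfl

/-- `(bgReadings 𝒟).dom = 𝒟`. [folklore] -/
@[simp] theorem bgReadings_dom (𝒟 : Set ((k : ℕ) → Fin d → (idx L M k → Matrix o o ℂ))) : (bgReadings L M 𝒟).dom = 𝒟 := rfl

/-- the reading, unfolded. [folklore] -/
theorem towerLoc_apply (k : ℕ) (W : (k : ℕ) → Fin d → (idx L M k → Matrix o o ℂ)) (s : Site L M o) :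
    towerLoc L M k W s = if s.re then (entryAt L M W k s).re else (entryAt L M W k s).im := rfl

/-- node U1b's `LocalRate` on `bgReadings 𝒟`, unfolded: every tower of the class has consecutive readings within `C θ^k` at every site.
[folklore] -/
theorem localRate_bgReadings_iff (𝒟 : Set ((k : ℕ) → Fin d → (idx L M k → Matrix o o ℂ))) (C θ : ℝ) :
    LocalRate (bgReadings L M 𝒟) C θ ↔ ∀ k : ℕ, ∀ W ∈ 𝒟, ∀ s : Site L M o, |towerLoc L M (k + 1) W s - towerLoc L M k W s| ≤ C * θ ^ k :=
  Iff.rfl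

/-! ## §2 Carrier functoriality of node U1b's shape -/

/-- **PULL-BACK**: if `(f, g)` maps the admissible data of `R'` into those of `R` and intertwines the local readings, `LocalRate R C θ` gives
`LocalRate R' C θ` (any carriers). [folklore] -/
theorem localRate_of_readingMap {ι ι' X X' : Type*} {R : Readings ι X} {R' : Readings ι' X'} (f : ι' → ι) (g : X' → X)
    (hdom : ∀ V' ∈ R'.dom, f V' ∈ R.dom) (hloc : ∀ k, ∀ V' ∈ R'.dom, ∀ x' : X', R'.loc k V' x' = R.loc k (f V') (g x'))
    {C θ : ℝ} (h : LocalRate R C θ) : LocalRate R' C θ := by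
  intro k V' hV' x'
  rw [hloc k V' hV' x', hloc (k + 1) V' hV' x']
  exact h k (f V') (hdom V' hV') (g x')

/-- **THE ADAPTER, GENERAL FORM**: a carrier `R` indexed by data `V : ι` with sites `J × Site L M o` whose reading at `(j, s)` is the NE2
entry-reading of the `j`-th tower `𝒲 V j` satisfies `LocalRate R C θ` IFF, for every admissible datum, the class `𝒟 V = Set.range (𝒲 V)` of its
towers satisfies `LocalRate (bgReadings L M (𝒟 V)) C θ` (row B6's hypothesis shape) — faithful both ways. [folklore] -/
theorem localRate_iff_forall_bgReadings {ι J : Type*} (R : Readings ι (J × Site L M o))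
    (𝒲 : ι → J → ((k : ℕ) → Fin d → (idx L M k → Matrix o o ℂ))) (𝒟 : ι → Set ((k : ℕ) → Fin d → (idx L M k → Matrix o o ℂ)))
    (hrange : ∀ V ∈ R.dom, Set.range (𝒲 V) = 𝒟 V)
    (hloc : ∀ k, ∀ V ∈ R.dom, ∀ (j : J) (s : Site L M o), R.loc k V (j, s) = towerLoc L M k (𝒲 V j) s) {C θ : ℝ} :
    LocalRate R C θ ↔ ∀ V ∈ R.dom, LocalRate (bgReadings L M (𝒟 V)) C θ := by
  constructor
  · intro h V hV k W hW s
    change W ∈ 𝒟 V at hW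
    rw [← hrange V hV, Set.mem_range] at hW
    obtain ⟨j, rfl⟩ := hW
    have h1 := h k V hV (j, s)
    rw [hloc k V hV j s, hloc (k + 1) V hV j s] at h1
    exact h1
  · rintro h k V hV ⟨j, s⟩
    rw [hloc k V hV j s, hloc (k + 1) V hV j s]
    have hW : 𝒲 V j ∈ 𝒟 V := by rw [← hrange V hV]; exact ⟨j, rfl⟩
    exact h V hV k (𝒲 V j) hW s

/-- rate/constant monotonicity of row B6's hypothesis (node U1b's `LocalRate.mono` BY NAME): a rate `θ ≤ L⁻¹` (e.g. NE3-(A)'s `θ = L⁻²`) gives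
the `L⁻¹` form ROOT B consumes. [folklore] -/
theorem localRate_bgReadings_lev_of_le (𝒟 : Set ((k : ℕ) → Fin d → (idx L M k → Matrix o o ℂ))) {C θ : ℝ} (hC : 0 ≤ C) (hθ0 : 0 ≤ θ)
    (hθL : θ ≤ (L : ℝ)⁻¹) (h : LocalRate (bgReadings L M 𝒟) C θ) : LocalRate (bgReadings L M 𝒟) C ((L : ℝ)⁻¹) :=
  h.mono le_rfl hθ0 hθL hC

/-! ## §3 Row B5's class `{w, D_νw_ν}`: the NE2 reading of a datum-indexed family of background towers and the adapter -/

section RowB5Class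

variable [DecidableEq o]

/-- row B5's class as a `Bool`-indexed family: `true ↦ w = connTower R`, `false ↦ D_νw_ν = dconnTower R`. [folklore] -/
def regFamily (R : (k : ℕ) → Fin d → (idx L M k → Matrix o o ℂ)) : Bool → ((k : ℕ) → Fin d → (idx L M k → Matrix o o ℂ)) :=
  fun b => bif b then connTower L M R else dconnTower L M R

/-- `Set.range (regFamily R) = regClass R`. [folklore] -/
theorem range_regFamily (R : (k : ℕ) → Fin d → (idx L M k → Matrix o o ℂ)) : Set.range (regFamily L M R) = regClass L M R := by
  ext W
  simp only [Set.mem_range, regClass, Set.mem_insert_iff, Set.mem_singleton_iff]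
  constructor
  · rintro ⟨b, rfl⟩
    cases b
    · exact Or.inr rfl
    · exact Or.inl rfl
  · rintro (rfl | rfl)
    · exact ⟨true, rfl⟩
    · exact ⟨false, rfl⟩

/-- **THE NE2 LOCAL READING ON A DATUM-INDEXED CARRIER** (row B5's class): for a family `Rt : ι → tower` of colour-transporter towers indexed by
the unit-lattice datum (DATA — no assertion that `Rt V` comes from Bałaban's minimisers `U_k(V)`), the reading of the `k`-step run for the datum
`V` at the site `(b, s)` is the NE2 entry-reading of `w(Rt V)` (`b = true`) or `D_νw_ν(Rt V)` (`b = false`) at `s`. [folklore] -/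
def ne2Loc {ι : Type*} (Rt : ι → ((k : ℕ) → Fin d → (idx L M k → Matrix o o ℂ))) : ℕ → ι → Bool × Site L M o → ℝ :=
  fun k V p => towerLoc L M k (regFamily L M (Rt V) p.1) p.2

/-- the reading at `(true, s)` is the NE2 entry-reading of the connection tower `w(Rt V)`. [folklore] -/
@[simp] theorem ne2Loc_true {ι : Type*} (Rt : ι → ((k : ℕ) → Fin d → (idx L M k → Matrix o o ℂ))) (k : ℕ) (V : ι) (s : Site L M o) :
    ne2Loc L M Rt k V (true, s) = towerLoc L M k (connTower L M (Rt V)) s := rfl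

/-- the reading at `(false, s)` is the NE2 entry-reading of the lattice-derivative tower `D_νw_ν(Rt V)`. [folklore] -/
@[simp] theorem ne2Loc_false {ι : Type*} (Rt : ι → ((k : ℕ) → Fin d → (idx L M k → Matrix o o ℂ))) (k : ℕ) (V : ι) (s : Site L M o) :
    ne2Loc L M Rt k V (false, s) = towerLoc L M k (dconnTower L M (Rt V)) s := rfl

/-- **THE c7 ADAPTER (row B5's class)**: a `V`-indexed carrier whose local reading IS `ne2Loc L M Rt` satisfies node U1b's `LocalRate … C θ` IFF
ROOT B's hypothesis `LocalRate (bgReadings L M (regClass L M (Rt V))) C θ` holds for EVERY admissible datum `V`. [folklore] -/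
theorem localRate_iff_forall_regClass {ι : Type*} (R : Readings ι (Bool × Site L M o))
    (Rt : ι → ((k : ℕ) → Fin d → (idx L M k → Matrix o o ℂ))) (hloc : R.loc = ne2Loc L M Rt) {C θ : ℝ} :
    LocalRate R C θ ↔ ∀ V ∈ R.dom, LocalRate (bgReadings L M (regClass L M (Rt V))) C θ :=
  localRate_iff_forall_bgReadings L M R (fun V => regFamily L M (Rt V)) (fun V => regClass L M (Rt V))
    (fun V _ => range_regFamily L M (Rt V)) (fun k V _ j s => by rw [hloc]; rfl)

/-- **ROOT B's `hNE3` FROM NODE U1b's SHAPE ON A `V`-INDEXED CARRIER**, with the rate monotonicity built in: a carrier reading `ne2Loc L M Rt` with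
`LocalRate R C θ`, `0 ≤ C`, `0 ≤ θ ≤ L⁻¹`, gives `LocalRate (bgReadings L M (regClass L M (Rt V))) C L⁻¹` for every admissible `V` — literally the
binder `hNE3` of `NE2BalabanThreshold.balaban_final_rate_of_regular` / `RegularBackgroundTower.perturbationLaws_covariantLaplacian_of_regular`
for the background `Rt V`. [folklore] -/
theorem localRate_regClass_of_localRate_lev {ι : Type*} {R : Readings ι (Bool × Site L M o)}
    {Rt : ι → ((k : ℕ) → Fin d → (idx L M k → Matrix o o ℂ))} (hloc : R.loc = ne2Loc L M Rt) {C θ : ℝ} (hC : 0 ≤ C) (hθ0 : 0 ≤ θ)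
    (hθL : θ ≤ (L : ℝ)⁻¹) (h : LocalRate R C θ) {V : ι} (hV : V ∈ R.dom) :
    LocalRate (bgReadings L M (regClass L M (Rt V))) C ((L : ℝ)⁻¹) :=
  localRate_bgReadings_lev_of_le L M _ hC hθ0 hθL ((localRate_iff_forall_regClass L M R Rt hloc).1 h V hV)

section Supplier

variable [NeZero L] [hM : ∀ μ, NeZero (M μ)] [Fintype o]

/-- **THE CONVERSE DIRECTION, AS A SUPPLIER's RECIPE**: to inhabit node U1b's `LocalRate` on a `V`-indexed carrier reading `ne2Loc L M Rt` it is
enough to give, for every admissible datum, the two-level operator-norm consistency `‖W (k+1) ν x′ − W k ν (parT x′)‖ ≤ β/L^k` of the two towers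
`w(Rt V)`, `D_νw_ν(Rt V)` (row B6's `localRate_of_consistent` BY NAME). [folklore] -/
theorem localRate_of_forall_consistent {ι : Type*} {R : Readings ι (Bool × Site L M o)}
    {Rt : ι → ((k : ℕ) → Fin d → (idx L M k → Matrix o o ℂ))} (hloc : R.loc = ne2Loc L M Rt) {β : ℝ}
    (h : ∀ V ∈ R.dom, ∀ W ∈ regClass L M (Rt V), ∀ k ν (x' : idx L M (k + 1)),
      ‖W (k + 1) ν x' - W k ν (BlockPairingGeometry.parT (lev L k) L M x')‖ ≤ β / (lev L k : ℕ)) :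
    LocalRate R β ((L : ℝ)⁻¹) :=
  (localRate_iff_forall_regClass L M R Rt hloc).2 fun V hV => NE2FromNE3.localRate_of_consistent L M (h V hV)

end Supplier

end RowB5Class

/-! ## §4 Row B2.w's class `{w} ∪ {D_lam w}` (referee c11): the same -/

section RowB2wClass

variable [DecidableEq o]

/-- row B2.w's class (the referee's c11 class) as an `Option (Fin d)`-indexed family: `none ↦ w = wT Rb`, `some lam ↦ D_lam w = DqT Rb lam`.
[folklore] -/
def regFamily₂ (Rb : (k : ℕ) → Fin d → Tor (fine (lev L k) M) → Matrix o o ℂ) :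
    Option (Fin d) → ((k : ℕ) → Fin d → (idx L M k → Matrix o o ℂ)) :=
  fun j => j.elim (wT L M Rb) (DqT L M Rb)

/-- `Set.range (regFamily₂ Rb) = regClass₂ Rb`. [folklore] -/
theorem range_regFamily₂ (Rb : (k : ℕ) → Fin d → Tor (fine (lev L k) M) → Matrix o o ℂ) :
    Set.range (regFamily₂ L M Rb) = regClass₂ L M Rb := by
  ext W
  simp only [Set.mem_range, regClass₂, Set.mem_insert_iff]
  constructor
  · rintro ⟨j, rfl⟩
    cases j with
    | none => exact Or.inl rfl
    | some lam => exact Or.inr ⟨lam, rfl⟩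
  · rintro (rfl | ⟨lam, rfl⟩)
    · exact ⟨none, rfl⟩
    · exact ⟨some lam, rfl⟩

/-- **THE NE2 LOCAL READING ON A DATUM-INDEXED CARRIER** (row B2.w's class `{w} ∪ {D_lam w}` of site-transporter towers `Rb V`, DATA). [folklore] -/
def ne2Loc₂ {ι : Type*} (Rb : ι → ((k : ℕ) → Fin d → Tor (fine (lev L k) M) → Matrix o o ℂ)) :
    ℕ → ι → Option (Fin d) × Site L M o → ℝ :=
  fun k V p => towerLoc L M k (regFamily₂ L M (Rb V) p.1) p.2

/-- the reading at `(none, s)` is the NE2 entry-reading of `w(Rb V) = wT`. [folklore] -/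
@[simp] theorem ne2Loc₂_none {ι : Type*} (Rb : ι → ((k : ℕ) → Fin d → Tor (fine (lev L k) M) → Matrix o o ℂ)) (k : ℕ) (V : ι) (s : Site L M o) :
    ne2Loc₂ L M Rb k V (none, s) = towerLoc L M k (wT L M (Rb V)) s := rfl

/-- the reading at `(some lam, s)` is the NE2 entry-reading of the forward quotient tower `D_lam w(Rb V) = DqT (Rb V) lam`. [folklore] -/
@[simp] theorem ne2Loc₂_some {ι : Type*} (Rb : ι → ((k : ℕ) → Fin d → Tor (fine (lev L k) M) → Matrix o o ℂ)) (lam : Fin d) (k : ℕ) (V : ι)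
    (s : Site L M o) : ne2Loc₂ L M Rb k V (some lam, s) = towerLoc L M k (DqT L M (Rb V) lam) s := rfl

/-- **THE c7 ADAPTER (row B2.w's class, referee c11)**: the same for `ne2Loc₂` and `regClass₂`. [folklore] -/
theorem localRate_iff_forall_regClass₂ {ι : Type*} (R : Readings ι (Option (Fin d) × Site L M o))
    (Rb : ι → ((k : ℕ) → Fin d → Tor (fine (lev L k) M) → Matrix o o ℂ)) (hloc : R.loc = ne2Loc₂ L M Rb) {C θ : ℝ} :
    LocalRate R C θ ↔ ∀ V ∈ R.dom, LocalRate (bgReadings L M (regClass₂ L M (Rb V))) C θ :=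
  localRate_iff_forall_bgReadings L M R (fun V => regFamily₂ L M (Rb V)) (fun V => regClass₂ L M (Rb V))
    (fun V _ => range_regFamily₂ L M (Rb V)) (fun k V _ j s => by rw [hloc]; rfl)

/-- the rate-monotone form for row B2.w's class: `LocalRate (bgReadings L M (regClass₂ L M (Rb V))) C L⁻¹` for every admissible `V` — the binder
`hNE3` of `HolonomyTowerRegular.perturbationLaws_hodgeCorrection_of_regular_localRate` for the background `Rb V`. [folklore] -/
theorem localRate_regClass₂_of_localRate_lev {ι : Type*} {R : Readings ι (Option (Fin d) × Site L M o)}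
    {Rb : ι → ((k : ℕ) → Fin d → Tor (fine (lev L k) M) → Matrix o o ℂ)} (hloc : R.loc = ne2Loc₂ L M Rb) {C θ : ℝ} (hC : 0 ≤ C)
    (hθ0 : 0 ≤ θ) (hθL : θ ≤ (L : ℝ)⁻¹) (h : LocalRate R C θ) {V : ι} (hV : V ∈ R.dom) :
    LocalRate (bgReadings L M (regClass₂ L M (Rb V))) C ((L : ℝ)⁻¹) :=
  localRate_bgReadings_lev_of_le L M _ hC hθ0 hθL ((localRate_iff_forall_regClass₂ L M R Rb hloc).1 h V hV)

end RowB2wClass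

end Summit.QuantumFields.BalabanUV.T4Continuum.NE2FromNE3Carrier

end
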